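import Literature.Geometry.Lorentzian.CauchyDevelopmentGlobalHyperbolicityProofs
import Literature.Geometry.Lorentzian.CauchyHypersurfaceCausalProofs
import Literature.Geometry.Lorentzian.NonImprisonmentProofs
import Literature.Geometry.Lorentzian.AchronalBoundary
import HarnessLib

/-!
# A Cauchy hypersurface above a compact set which agrees with a given one off a compact set

#harness_tags [topic Geometry/Lorentzian]

Let `(M, g, τ)` be a time-oriented Lorentzian manifold (Hausdorff, second countable,
finite-dimensional model, no boundary, `Cⁿ` metric with `n ≥ 2`) with a Cauchy hypersurface `S`
(`LorentzianMetric.IsCauchyHypersurface`: met exactly once by every endless timelike curve,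
O'Neill 1983, Def. 14.28), strongly causal, with compact "shadows" `J⁻(x) ∩ J⁺(S)` and closed point
pasts `J⁻(x)` — all three hold in every Cauchy development
(`Literature.Geometry.Lorentzian.CauchyDevelopmentGlobalHyperbolicityProofs`). We prove:

* `LorentzianMetric.IsCauchyHypersurface.exists_isCauchyHypersurface_above` — **for every compact
  `C ⊆ M` there is a Cauchy hypersurface `A` with `C ⊆ I⁻(A)`, `S ⊆ J⁻(A)`, `A ⊆ J⁺(S)`, which
  coincides with `S` off a compact set** (`A ∖ K ⊆ S` and `S ∖ K ⊆ A` for a compact `K`);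
* `CauchyDevelopment.exists_isCauchyHypersurface_above` — the same for the spacetime of a Cauchy
  development `𝒟` of an initial data set, with `S = ι(X)` the embedded data hypersurface.

## The construction (an achronal boundary; Hawking–Ellis 1973, Prop. 6.3.1, 6.4.7, 6.6.6)

Cover `C` by finitely many chronological pasts `I⁻(k)`, `k ∈ F` (`F` finite: every point has a
point in its chronological future, and `I⁻(k)` is open, `CausalityOpennessProofs`). The open past
set `P = I⁻(S) ∪ I⁻(F)` has achronal boundary `A = ∂P = cl P ∖ P` (Hawking–Ellis, Prop. 6.3.1:
`LorentzianMetric.IsPastSet.isAchronal_frontier`, `AchronalBoundary.lean`). Since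
`cl P ⊆ cl I⁻(S) ∪ J⁻(F)` (`J⁻(F)` is a finite union of closed sets `J⁻(k)`), `cl I⁻(S)` misses
`I⁺(S)` and `M = I⁻(S) ⊔ S ⊔ I⁺(S)` (O'Neill 1983, Lemma 14.29), the boundary `A` agrees with `S`
off the compact set `K = J⁻(F) ∩ J⁺(S) = ⋃_{k ∈ F} (J⁻(k) ∩ J⁺(S))` (Hawking–Ellis, Prop. 6.6.6).
Every endless timelike curve `γ` meets `A` at most once (achronality) and at least once: at its
crossing `γ(t₀) ∈ S ⊆ cl P` it is in `P` (or already in `A`); after `t₀` it lies in `I⁺(S)`, so as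
long as it stays in `cl P` it stays in the compact `K` — impossible for all later parameters by
non-imprisonment under strong causality (Hawking–Ellis, Prop. 6.4.7; O'Neill, Lemma 14.13:
`LorentzianMetric.IsStronglyCausal.exists_forall_notMem`); by connectedness of `γ([t₀, t₁])` it
crosses `∂P`. Finally `P ⊆ I⁻(A)` (the endless timelike curve through `x ∈ P` meets `A`, necessarily
to the future of `x` since `P` is a past set disjoint from `A`), whence `C ⊆ I⁻(F) ⊆ P ⊆ I⁻(A)` and
`S ⊆ cl P = P ∪ A ⊆ J⁻(A)`. This is the argument of Bernal–Sánchez 2006, §3 (topological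
extension of a compact achronal set to a Cauchy hypersurface, via non-imprisonment in the compact
`J⁻(γ(s₀)) ∩ J⁺(K)`), arranged so that the new hypersurface keeps `S` outside a compact set.

Everything is proved; no definitions and no named facts are introduced (D-0026).

## References

* S. W. Hawking, G. F. R. Ellis, *The large scale structure of space-time*, CUP 1973, §6.3,
  Prop. 6.3.1 (p. 187); §6.4, Prop. 6.4.7 (p. 195); §6.6, Prop. 6.6.6 (p. 211). [HawkingEllis1973CUP]
* B. O'Neill, *Semi-Riemannian geometry with applications to relativity*, Academic Press 1983,
  Ch. 14, Lemma 14.13 (p. 407), Lemma 14.22 (p. 412), Def. 14.28 and Lemma 14.29 (p. 415),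
  Lemma 14.40 (p. 423). [ONeillSemiRiemannian1983]
* A. N. Bernal, M. Sánchez, *Further results on the smoothability of Cauchy hypersurfaces and
  Cauchy time functions*, Lett. Math. Phys. 77 (2006) 183–197, arXiv:gr-qc/0512095, Thm. 1.1 and
  §3 (topological version). [BernalSanchez2006]
-/

open Set Filter Function Topology
open scoped Manifold ContDiff Topology

namespace Literature.Geometry.Lorentzian

universe u

variable {E : Type*} [NormedAddCommGroup E] [NormedSpace ℝ E] {H : Type*} [TopologicalSpace H]
  {I : ModelWithCorners ℝ E H} {n : ℕ∞ω} {M : Type*} [TopologicalSpace M] [ChartedSpace H M]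
  [IsManifold I ∞ M]

namespace LorentzianMetric

variable {g : LorentzianMetric I n M} {τ : TimeOrientation g}

/-- A point of a Cauchy hypersurface `S` is not in `I⁻(S)` (achronality, O'Neill 1983, Ch. 14,
Lemma 14.29: `M` is the *disjoint* union `I⁻(S) ⊔ S ⊔ I⁺(S)`). [cite: ONeillSemiRiemannian1983, Ch. 14, Lemma 14.29 (p. 415)] -/
theorem IsCauchyHypersurface.notMem_chronologicalPast_of_mem [T2Space M]
    [SecondCountableTopology M] [BoundarylessManifold I M] [FiniteDimensional ℝ E] (hn : 2 ≤ n)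
    {S : Set M} (hS : g.IsCauchyHypersurface τ S) {x : M} (hx : x ∈ S) :
    x ∉ g.chronologicalPast τ S := by
  rintro ⟨s₂, hs₂, γ, a, b, hab, hγ, ha, hb⟩
  have hxs : x ∈ g.chronologicalPast τ {s₂} := ⟨s₂, rfl, γ, a, b, hab, hγ, ha, hb⟩
  exact IsCauchyHypersurface.isAchronal_holds (g := g) (τ := τ) hn hS x hx s₂ hs₂
    (mem_chronologicalFuture_of_mem_chronologicalPast hxs)

/-- A point of a Cauchy hypersurface `S` is not in `I⁺(S)` (achronality, O'Neill 1983, Ch. 14,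
Lemma 14.29). [cite: ONeillSemiRiemannian1983, Ch. 14, Lemma 14.29 (p. 415)] -/
theorem IsCauchyHypersurface.notMem_chronologicalFuture_of_mem [T2Space M]
    [SecondCountableTopology M] [BoundarylessManifold I M] [FiniteDimensional ℝ E] (hn : 2 ≤ n)
    {S : Set M} (hS : g.IsCauchyHypersurface τ S) {x : M} (hx : x ∈ S) :
    x ∉ g.chronologicalFuture τ S := by
  rintro ⟨s₁, hs₁, γ, a, b, hab, hγ, ha, hb⟩
  exact IsCauchyHypersurface.isAchronal_holds (g := g) (τ := τ) hn hS s₁ hs₁ x hx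
    ⟨s₁, rfl, γ, a, b, hab, hγ, ha, hb⟩

/-- `I⁺(S)` and `I⁻(S)` of a Cauchy hypersurface `S` are disjoint: `s₁ ≪ y ≪ s₂` with
`s₁, s₂ ∈ S` contradicts achronality (O'Neill 1983, Ch. 14, Lemma 14.29, "disjoint union").
[cite: ONeillSemiRiemannian1983, Ch. 14, Lemma 14.29 (p. 415)] -/
theorem IsCauchyHypersurface.notMem_chronologicalPast_of_mem_chronologicalFuture [T2Space M]
    [SecondCountableTopology M] [BoundarylessManifold I M] [FiniteDimensional ℝ E] (hn : 2 ≤ n)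
    {S : Set M} (hS : g.IsCauchyHypersurface τ S) {y : M} (hy : y ∈ g.chronologicalFuture τ S) :
    y ∉ g.chronologicalPast τ S := by
  rintro ⟨s₂, hs₂, γ, a, b, hab, hγ, ha, hb⟩
  have hys : y ∈ g.chronologicalPast τ {s₂} := ⟨s₂, rfl, γ, a, b, hab, hγ, ha, hb⟩
  exact hS.notMem_chronologicalFuture_of_mem hn hs₂
    (mem_chronologicalFuture_trans hy (mem_chronologicalFuture_of_mem_chronologicalPast hys))

/-- **A Cauchy hypersurface above a compact set, equal to the given one off a compact set.**
On a Hausdorff, second countable, finite-dimensional manifold without boundary with a `Cⁿ`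
(`n ≥ 2`) time-oriented Lorentzian metric, let `S` be a Cauchy hypersurface, let `(g, τ)` be
strongly causal with compact `J⁻(x) ∩ J⁺(S)` and closed `J⁻(x)` for every `x` (as in every Cauchy
development), and let `C` be compact. Then there is a Cauchy hypersurface `A` with:
`A ∖ K ⊆ S` and `S ∖ K ⊆ A` for some compact `K`; `C ⊆ I⁻(A)`; `S ⊆ J⁻(A)`; `A ⊆ J⁺(S)`.
Construction: `A = ∂(I⁻(S) ∪ I⁻(F))` for a finite `F` with `C ⊆ I⁻(F)`, an achronal boundary
(Hawking–Ellis 1973, Prop. 6.3.1) which every endless timelike curve crosses by non-imprisonment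
(Prop. 6.4.7) in the compact `J⁻(F) ∩ J⁺(S)` (Prop. 6.6.6); see the module docstring. The
argument is that of Bernal–Sánchez 2006, §3 (topological extension to a Cauchy hypersurface).
[cite: HawkingEllis1973CUP, §6.3 Prop. 6.3.1 (p. 187), §6.4 Prop. 6.4.7 (p. 195), §6.6 Prop. 6.6.6 (p. 211)]
[cite: BernalSanchez2006, §3 and Thm. 1.1 (arXiv gr-qc/0512095)] -/
theorem IsCauchyHypersurface.exists_isCauchyHypersurface_above [T2Space M]
    [SecondCountableTopology M] [BoundarylessManifold I M] [FiniteDimensional ℝ E] (hn : 2 ≤ n)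
    {S : Set M} (hS : g.IsCauchyHypersurface τ S) (hsc : g.IsStronglyCausal τ)
    (hcpt : ∀ x : M, IsCompact (g.causalPast τ {x} ∩ g.causalFuture τ S))
    (hcl : ∀ x : M, IsClosed (g.causalPast τ {x})) {C : Set M} (hC : IsCompact C) :
    ∃ A : Set M, g.IsCauchyHypersurface τ A ∧
      (∃ K : Set M, IsCompact K ∧ A \ K ⊆ S ∧ S \ K ⊆ A) ∧
      C ⊆ g.chronologicalPast τ A ∧ S ⊆ g.causalPast τ A ∧ A ⊆ g.causalFuture τ S := by
  -- the trichotomy `M = I⁻(S) ⊔ S ⊔ I⁺(S)` and the disjointness relations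
  have htri : ∀ p : M, p ∉ S → p ∈ g.chronologicalFuture τ S ∪ g.chronologicalPast τ S :=
    fun p hp ↦ hS.mem_chronologicalFuture_union_chronologicalPast hn hp
  -- Step 1: finitely many chronological pasts `I⁻(f c)` cover `C`
  have hfut : ∀ c : M, ∃ c' : M, c ∈ g.chronologicalPast τ {c'} := by
    intro c
    obtain ⟨γ, ε, hε, h0, hγ⟩ := g.exists_isFutureTimelikeCurveOn_Ioo_of_isInteriorPoint τ
      (BoundarylessManifold.isInteriorPoint (I := I) (x := c))
    refine ⟨γ (ε / 2), mem_chronologicalPast_of_mem_chronologicalFuture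
      ⟨c, rfl, γ, 0, ε / 2, by linarith, hγ.mono (Icc_subset_Ioo (by linarith) (by linarith)),
        h0, rfl⟩⟩
  choose f hf using hfut
  obtain ⟨T, hT⟩ := hC.elim_finite_subcover (fun c : M ↦ g.chronologicalPast τ {f c})
    (fun c ↦ isOpen_chronologicalPast_of_boundaryless g τ _)
    (fun c _ ↦ mem_iUnion.2 ⟨c, hf c⟩)
  set F : Set M := f '' (T : Set M) with hFdef
  have hFfin : F.Finite := T.finite_toSet.image f
  -- Step 2: the open past set `P = I⁻(S) ∪ I⁻(F)`, its boundary `A`, the compact `K`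
  set P : Set M := g.chronologicalPast τ S ∪ g.chronologicalPast τ F with hPdef
  have hPopen : IsOpen P :=
    (isOpen_chronologicalPast_of_boundaryless g τ S).union
      (isOpen_chronologicalPast_of_boundaryless g τ F)
  have hPpast : g.IsPastSet τ P := by
    rintro x ⟨p, hp, γ, a, b, hab, hγ, ha, hb⟩
    have hxp : x ∈ g.chronologicalPast τ {p} := ⟨p, rfl, γ, a, b, hab, hγ, ha, hb⟩
    rcases hp with hp | hp
    · exact Or.inl (mem_chronologicalFuture_trans (τ := τ.reverse) hp hxp)
    · exact Or.inr (mem_chronologicalFuture_trans (τ := τ.reverse) hp hxp)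
  set A : Set M := frontier P with hAdef
  have hAeq : A = closure P \ P := hPopen.frontier_eq
  have hA_cl : ∀ {x}, x ∈ A → x ∈ closure P := fun hx ↦ (hAeq ▸ hx).1
  have hA_nP : ∀ {x}, x ∈ A → x ∉ P := fun hx ↦ (hAeq ▸ hx).2
  have hA_of : ∀ {x}, x ∈ closure P → x ∉ P → x ∈ A := fun h₁ h₂ ↦ hAeq ▸ ⟨h₁, h₂⟩
  set Km : Set M := ⋃ k ∈ F, (g.causalPast τ {k} ∩ g.causalFuture τ S) with hKmdef
  have hKm : IsCompact Km := hFfin.isCompact_biUnion fun k _ ↦ hcpt k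
  have hJF : g.causalPast τ F = ⋃ k ∈ F, g.causalPast τ {k} :=
    causalFuture_eq_biUnion (τ := τ.reverse) F
  have hJFcl : IsClosed (g.causalPast τ F) := by
    rw [hJF]
    exact hFfin.isClosed_biUnion fun k _ ↦ hcl k
  have hclIF : closure (g.chronologicalPast τ F) ⊆ g.causalPast τ F :=
    closure_minimal (chronologicalFuture_subset_causalFuture g τ.reverse F) hJFcl
  have hclIS : ∀ x ∈ closure (g.chronologicalPast τ S), x ∉ g.chronologicalFuture τ S := by
    intro x hx hxI
    obtain ⟨y, hyI, hyP⟩ := mem_closure_iff_nhds.mp hx _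
      ((isOpen_chronologicalFuture_of_boundaryless g τ S).mem_nhds hxI)
    exact hS.notMem_chronologicalPast_of_mem_chronologicalFuture hn hyI hyP
  have hclP : closure P ⊆ closure (g.chronologicalPast τ S) ∪ g.causalPast τ F := by
    rw [hPdef, closure_union]
    exact union_subset_union_right _ hclIF
  have hScl : S ⊆ closure P := fun x hx ↦
    closure_mono subset_union_left (subset_closure_chronologicalFuture g τ.reverse S hx)
  -- membership in `J⁻(F)` together with `J⁺(S)` means membership in `Km`
  have hmemKm : ∀ {x}, x ∈ g.causalPast τ F → x ∈ g.causalFuture τ S → x ∈ Km := by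
    intro x hxF hxS
    rw [hJF] at hxF
    obtain ⟨k, hk, hxk⟩ := mem_iUnion₂.mp hxF
    exact mem_iUnion₂.mpr ⟨k, hk, hxk, hxS⟩
  -- Step 3: `A` agrees with `S` off `Km`
  have hA_sub : A \ Km ⊆ S := by
    rintro a ⟨haA, haKm⟩
    have haP : a ∉ P := hA_nP haA
    rcases hclP (hA_cl haA) with ha | ha
    · by_contra haS
      rcases htri a haS with h | h
      · exact hclIS a ha h
      · exact haP (Or.inl h)
    · exfalso
      have haJS : a ∉ g.causalFuture τ S := fun h ↦ haKm (hmemKm ha h)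
      have haS : a ∉ S := fun h ↦ haJS (subset_causalFuture g τ S h)
      rcases htri a haS with h | h
      · exact haJS (chronologicalFuture_subset_causalFuture g τ S h)
      · exact haP (Or.inl h)
  have hS_sub : S \ Km ⊆ A := by
    rintro x ⟨hxS, hxKm⟩
    refine hA_of (hScl hxS) ?_
    rintro (hx | hx)
    · exact hS.notMem_chronologicalPast_of_mem hn hxS hx
    · exact hxKm (hmemKm (chronologicalFuture_subset_causalFuture g τ.reverse F hx)
        (subset_causalFuture g τ S hxS))
  -- Step 4: `A` is a Cauchy hypersurface
  have hAach : g.IsAchronal τ A := hPpast.isAchronal_frontier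
  have hAcauchy : g.IsCauchyHypersurface τ A := by
    intro γ s hγ
    obtain ⟨hs, hγt, hfe, hpe⟩ := hγ
    have hrel : ∀ {t₁ t₂ : ℝ}, t₁ ∈ s → t₂ ∈ s → t₁ < t₂ →
        γ t₂ ∈ g.chronologicalFuture τ {γ t₁} := fun {t₁ t₂} ht₁ ht₂ hlt ↦
      ⟨γ t₁, rfl, γ, t₁, t₂, hlt, hγt.mono (hs.out ht₁ ht₂), rfl, rfl⟩
    have huniq : ∀ t₁ t₂ : ℝ, (t₁ ∈ s ∧ γ t₁ ∈ A) → (t₂ ∈ s ∧ γ t₂ ∈ A) → t₁ = t₂ := by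
      intro t₁ t₂ h₁ h₂
      by_contra hne
      rcases lt_or_gt_of_ne hne with hlt | hlt
      · exact hAach _ h₁.2 _ h₂.2 (hrel h₁.1 h₂.1 hlt)
      · exact hAach _ h₂.2 _ h₁.2 (hrel h₂.1 h₁.1 hlt)
    obtain ⟨t₀, ⟨ht₀s, ht₀S⟩, -⟩ := hS γ s ⟨hs, hγt, hfe, hpe⟩
    suffices hex : ∃ t ∈ s, γ t ∈ A by
      obtain ⟨t, hts, htA⟩ := hex
      exact ⟨t, ⟨hts, htA⟩, fun t' ht' ↦ huniq t' t ht' ⟨hts, htA⟩⟩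
    by_cases h0 : γ t₀ ∈ A
    · exact ⟨t₀, ht₀s, h0⟩
    have hP₀ : γ t₀ ∈ P := by
      by_contra hnP
      exact h0 (hA_of (hScl ht₀S) hnP)
    -- non-imprisonment in `Km`: a parameter `t₁ > t₀` with `γ t₁ ∉ cl P`
    obtain ⟨tK, htKs, htK⟩ :=
      hsc.exists_forall_notMem hn hKm hs hγt.isFutureCausalCurveOn hfe
    have hmax : max t₀ tK ∈ s := by
      rcases le_total t₀ tK with h | h
      · rwa [max_eq_right h]
      · rwa [max_eq_left h]
    obtain ⟨t₁, ht₁s, ht₁⟩ := hfe.exists_gt hmax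
    have ht₀₁ : t₀ < t₁ := lt_of_le_of_lt (le_max_left _ _) ht₁
    have htK₁ : tK ≤ t₁ := ((le_max_right _ _).trans ht₁.le)
    have hγ₁I : γ t₁ ∈ g.chronologicalFuture τ S :=
      ⟨γ t₀, ht₀S, γ, t₀, t₁, ht₀₁, hγt.mono (hs.out ht₀s ht₁s), rfl, rfl⟩
    have hγ₁ : γ t₁ ∉ closure P := by
      intro hcl'
      rcases hclP hcl' with h | h
      · exact hclIS _ h hγ₁I
      · exact htK t₁ ht₁s htK₁ (hmemKm h (chronologicalFuture_subset_causalFuture g τ S hγ₁I))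
    -- connectedness of `γ([t₀, t₁])`
    have hIcc : Icc t₀ t₁ ⊆ s := hs.out ht₀s ht₁s
    have hcont : ContinuousOn γ (Icc t₀ t₁) := fun t ht ↦
      (hγt.isFutureCausalCurveOn.continuousAt (hIcc ht)).continuousWithinAt
    have hconn : IsPreconnected (γ '' Icc t₀ t₁) := isPreconnected_Icc.image γ hcont
    by_contra hnone
    push Not at hnone
    have hcover : γ '' Icc t₀ t₁ ⊆ P ∪ (closure P)ᶜ := by
      rintro _ ⟨t, ht, rfl⟩
      by_cases hP : γ t ∈ P
      · exact Or.inl hP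
      · exact Or.inr fun hcl' ↦ hnone t (hIcc ht) (hA_of hcl' hP)
    obtain ⟨y, -, hyP, hycl⟩ := hconn P (closure P)ᶜ hPopen isClosed_closure.isOpen_compl hcover
      ⟨γ t₀, mem_image_of_mem γ (left_mem_Icc.2 ht₀₁.le), hP₀⟩
      ⟨γ t₁, mem_image_of_mem γ (right_mem_Icc.2 ht₀₁.le), hγ₁⟩
    exact hycl (subset_closure hyP)
  -- Step 5: `P ⊆ I⁻(A)`
  have hPA : P ⊆ g.chronologicalPast τ A := by
    intro x hx
    obtain ⟨Δ, Dm, hΔ, h0D, hΔ0⟩ := exists_isEndlessTimelikeCurve_through (g := g) (τ := τ) hn x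
    obtain ⟨tA, ⟨htAD, htAA⟩, -⟩ := hAcauchy Δ Dm hΔ
    have hApos : 0 < tA := by
      rcases lt_trichotomy tA 0 with h | h | h
      · exfalso
        have h1 : x ∈ g.chronologicalFuture τ {Δ tA} :=
          ⟨Δ tA, rfl, Δ, tA, 0, h, hΔ.2.1.mono (hΔ.1.out htAD h0D), rfl, hΔ0⟩
        exact hA_nP htAA (hPpast (chronologicalPast_mono (singleton_subset_iff.2 hx)
          (mem_chronologicalPast_of_mem_chronologicalFuture h1)))
      · exfalso
        subst h
        rw [hΔ0] at htAA
        exact hA_nP htAA hx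
      · exact h
    have h1 : Δ tA ∈ g.chronologicalFuture τ {x} :=
      ⟨x, rfl, Δ, 0, tA, hApos, hΔ.2.1.mono (hΔ.1.out h0D htAD), hΔ0, rfl⟩
    exact chronologicalPast_mono (singleton_subset_iff.2 htAA)
      (mem_chronologicalPast_of_mem_chronologicalFuture h1)
  -- Step 6: conclusion
  refine ⟨A, hAcauchy, ⟨Km, hKm, hA_sub, hS_sub⟩, ?_, ?_, ?_⟩
  · intro c hc
    obtain ⟨i, hi, hci⟩ := mem_iUnion₂.mp (hT hc)
    exact hPA (Or.inr (chronologicalPast_mono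
      (singleton_subset_iff.2 (mem_image_of_mem f (Finset.mem_coe.2 hi))) hci))
  · intro x hxS
    by_cases hxP : x ∈ P
    · exact chronologicalFuture_subset_causalFuture g τ.reverse A (hPA hxP)
    · exact subset_causalPast g τ A (hA_of (hScl hxS) hxP)
  · intro a ha
    by_cases haKm : a ∈ Km
    · obtain ⟨k, -, -, hk⟩ := mem_iUnion₂.mp haKm
      exact hk
    · exact subset_causalFuture g τ S (hA_sub ⟨ha, haKm⟩)

end LorentzianMetric

/-! ### Cauchy developments -/

namespace CauchyDevelopment

variable {m : ℕ} {X : Type u} [TopologicalSpace X] [ChartedSpace (EuclideanSpace ℝ (Fin m)) X]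
  [IsManifold (𝓡 m) ∞ X] [ConnectedSpace X] {D : InitialDataSet (𝓡 m) X}

/-- **In a Cauchy development there is, above every compact set, a Cauchy hypersurface equal to
the data hypersurface off a compact set.** For the spacetime `(M, g, τ)` of a Cauchy development
`𝒟` of initial data on `X` (data hypersurface `ι(X)` a Cauchy hypersurface) and every compact
`C ⊆ M` there is a Cauchy hypersurface `A ⊆ M` with `A ∖ K ⊆ ι(X)`, `ι(X) ∖ K ⊆ A` for a compact `K`,
`C ⊆ I⁻(A)`, `ι(X) ⊆ J⁻(A)` and `A ⊆ J⁺(ι(X))`. The hypotheses of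
`IsCauchyHypersurface.exists_isCauchyHypersurface_above` hold by
`CauchyDevelopment.isStronglyCausal`, `….isCompact_causalPast_inter_causalFuture_range`,
`….isClosed_causalPast_singleton` (Hawking–Ellis 1973, Prop. 6.6.3, 6.6.6; O'Neill 1983,
Lemma 14.22). [cite: HawkingEllis1973CUP, §6.3 Prop. 6.3.1, §6.6 Prop. 6.6.6 (pp. 187, 211)] -/
theorem exists_isCauchyHypersurface_above (𝒟 : CauchyDevelopment D) {C : Set 𝒟.carrier}
    (hC : IsCompact C) :
    ∃ A : Set 𝒟.carrier, 𝒟.metric.IsCauchyHypersurface 𝒟.timeOrientation A ∧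
      (∃ K : Set 𝒟.carrier, IsCompact K ∧ A \ K ⊆ range 𝒟.embed ∧ range 𝒟.embed \ K ⊆ A) ∧
      C ⊆ 𝒟.metric.chronologicalPast 𝒟.timeOrientation A ∧
      range 𝒟.embed ⊆ 𝒟.metric.causalPast 𝒟.timeOrientation A ∧
      A ⊆ 𝒟.metric.causalFuture 𝒟.timeOrientation (range 𝒟.embed) := by
  have h2 : (2 : ℕ∞ω) ≤ ∞ := WithTop.coe_le_coe.mpr le_top
  exact 𝒟.isCauchyHypersurface.exists_isCauchyHypersurface_above h2 𝒟.isStronglyCausal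
    𝒟.isCompact_causalPast_inter_causalFuture_range 𝒟.isClosed_causalPast_singleton hC

end CauchyDevelopment

end Literature.Geometry.Lorentzian
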